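import Mathlib
import Literature.LinearAlgebra.Matrix.EckartYoungMirsky

/-!
# The Frobenius norm and the singular values: `‖A‖_F² = Σ_k σ_k(A)²`
# (with Eckart–Young in the Frobenius norm)

For a linear map `T : E → F` between finite-dimensional inner product spaces over `𝕜 = ℝ, ℂ`
and any orthonormal basis `(b_i)` of `E`,

  `Σ_i ‖T b_i‖² = re tr (T†T) = Σ_k σ_k(T)²`,

and consequently, for a matrix `A : Matrix m n 𝕜` (any finite index types),

  `Σ_{i,j} |a_ij|² = re tr (AᴴA) = Σ_{k < |n|} σ_k(A)² = ‖A‖_F²`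

([GolubVanLoan2013, §2.4.2 Cor 2.4.3]: `‖A‖_F = √(σ₁² + ⋯ + σ_p²)`, `p = min{m, n}`;
[HornJohnson2013, §5.6 (5.6.0.2)]).  Singular values are Mathlib's `LinearMap.singularValues`
(`ℕ →₀ ℝ`, antitone, **zero-indexed**: `σ₀ = σ_max`), for a matrix those of
`Matrix.toEuclideanLin A`, exactly as in `Literature.LinearAlgebra.Matrix.EckartYoungMirsky`,
whose Courant–Fischer halves for singular values this file reuses.

Consequences recorded here (all with `S := Σ_{i,j} |a_ij|²`):

* `σ₀(A)² ≤ S ≤ rank A · σ₀(A)² ≤ min{|m|,|n|} · σ₀(A)²` — the comparison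
  `‖A‖₂ ≤ ‖A‖_F ≤ √min{m,n} ‖A‖₂` [GolubVanLoan2013, §2.3.2 (2.3.7)];
* `(k+1) σ_k(A)² ≤ S` and `σ₀(A)² + k σ_k(A)² ≤ S` (Chebyshev on the antitone sequence `σ`): the
  steps `√(r+1) σ_{r+1}(A) ≤ ‖A‖_F ≤ (r+1) ‖A‖_C` of [AllenLaiShen2024, §3 Lemma 3 and the display
  before it] and `‖L‖₂² ≤ ‖L‖_F² − r σ_min(L)²` of [AllenLaiShen2024, §3 (proof of Thm 3)]; in
  particular
  `σ_k(A) ≤ δ √(|m| |n| / (k+1))` when all `|a_ij| ≤ δ`;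
* **Weyl's rank-perturbation inequality** `σ_{i+k}(A) ≤ σ_i(A − B)` for `rank B ≤ k`
  ([HornJohnson2013, §7.3 (7.3.13)] with `σ_{k+1}(B) = 0`), at operator and matrix level;
* **Eckart–Young in the Frobenius norm** [EckartYoung1936, p. 216 Eq. (17)],
  [HornJohnson2013, §7.4.2], [GolubVanLoan2013, §2.4.2 Thm 2.4.8 and the remark following it]:
  `Σ_{j ≥ k} σ_j(A)² ≤ Σ_{i,j} |(A − B)_ij|²` for every `B` of rank `≤ k`, with equality for the
  truncated singular value decomposition (the same rank-`≤ k` matrix that is optimal in the spectral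
  norm).

A real-`Fin`-matrix version of the Frobenius identity and of the Frobenius Eckart–Young bound in the
language of `Matrix.IsHermitian.eigenvalues₀ (AᵀA)` already exists in
`Literature.Computability.QuantumComplexity.SampleQuery.LinearTimeSVD`
(`frobSq_eq_sum_eigenvalues₀`, `sum_tail_eigenvalues₀_le_frobSq_sub`); the present file is the
`RCLike` / arbitrary-index / `singularValues` form and does not import that development.
-/

noncomputable section

open scoped InnerProductSpace
open Module

namespace Literature.LinearAlgebra.Matrix

/-! ## Part I. Linear maps between finite-dimensional inner product spaces -/

section Operator

variable {𝕜 : Type*} [RCLike 𝕜] {E F : Type*} [NormedAddCommGroup E] [InnerProductSpace 𝕜 E]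
  [FiniteDimensional 𝕜 E] [NormedAddCommGroup F] [InnerProductSpace 𝕜 F] [FiniteDimensional 𝕜 F]
  {n : ℕ}

/-- **`Σ_i ‖T b_i‖² = Σ_k σ_k(T)²` for every orthonormal basis `(b_i)`**: the Hilbert–Schmidt
(Frobenius) norm is `√(re tr T†T) = √(Σ σ_k²)` (`tr AA*` is the sum of the eigenvalues of `AA*`,
which are the squares of the singular values). [cite: HornJohnson2013, §5.6 (5.6.0.2)]
[cite: GolubVanLoan2013, §2.4.2 Cor 2.4.3] -/
theorem sum_sq_norm_apply_orthonormalBasis_eq_sum_sq_singularValues {ι : Type*} [Fintype ι]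
    (T : E →ₗ[𝕜] F) (hn : finrank 𝕜 E = n) (b : OrthonormalBasis ι 𝕜 E) :
    ∑ i, ‖T (b i)‖ ^ 2 = ∑ k : Fin n, T.singularValues k ^ 2 := by
  have h1 : ∀ i, ‖T (b i)‖ ^ 2 =
      RCLike.re ⟪b i, (LinearMap.adjoint T ∘ₗ T) (b i)⟫_𝕜 := fun i => by
    have hc : ⟪b i, (LinearMap.adjoint T ∘ₗ T) (b i)⟫_𝕜 =
        (starRingEnd 𝕜) ⟪(LinearMap.adjoint T ∘ₗ T) (b i), b i⟫_𝕜 :=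
      (inner_conj_symm _ _).symm
    rw [hc, RCLike.conj_re, re_inner_adjoint_comp_self_apply]
  simp_rw [h1]
  rw [← map_sum, ← LinearMap.trace_eq_sum_inner (LinearMap.adjoint T ∘ₗ T) b,
    T.isSymmetric_adjoint_comp_self.re_trace_eq_sum_eigenvalues hn]
  exact Finset.sum_congr rfl fun k _ => (T.sq_singularValues_fin hn k).symm

/-- The tail `σ_k`, `k ≥ dim E`, vanishes, so `Σ_{k < d} σ_k² = Σ_{k < dim E} σ_k²` for every
`d ≥ dim E`. [cite: GolubVanLoan2013, §2.4.2 Cor 2.4.3] -/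
theorem sum_range_sq_singularValues_eq (T : E →ₗ[𝕜] F) (hn : finrank 𝕜 E = n) {d : ℕ}
    (hd : n ≤ d) :
    ∑ k ∈ Finset.range d, T.singularValues k ^ 2 = ∑ k : Fin n, T.singularValues k ^ 2 := by
  rw [Fin.sum_univ_eq_sum_range (fun k => T.singularValues k ^ 2) n]
  refine (Finset.sum_subset (Finset.range_mono hd) fun k _ hk => ?_).symm
  rw [Finset.mem_range, not_lt] at hk
  rw [T.singularValues_of_finrank_le (hn.trans_le hk), zero_pow two_ne_zero]

/-- `Σ_i ‖T b_i‖² = Σ_{k < d} σ_k(T)²` for any `d ≥ dim E`. [cite: HornJohnson2013, §5.6 (5.6.0.2)]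
[cite: GolubVanLoan2013, §2.4.2 Cor 2.4.3] -/
theorem sum_sq_norm_apply_orthonormalBasis_eq_sum_range {ι : Type*} [Fintype ι]
    (T : E →ₗ[𝕜] F) (hn : finrank 𝕜 E = n) (b : OrthonormalBasis ι 𝕜 E) {d : ℕ} (hd : n ≤ d) :
    ∑ i, ‖T (b i)‖ ^ 2 = ∑ k ∈ Finset.range d, T.singularValues k ^ 2 := by
  rw [sum_range_sq_singularValues_eq T hn hd,
    sum_sq_norm_apply_orthonormalBasis_eq_sum_sq_singularValues T hn b]

/-! ### Chebyshev-type consequences of `σ₀ ≥ σ₁ ≥ ⋯ ≥ 0` -/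

/-- **`(k+1) σ_k² ≤ Σ_j σ_j²`** (the `k+1` largest singular values are all `≥ σ_k`); this is
`‖M‖_F ≥ √(r+1) σ_{r+1}(M)` (one-indexed) of the cited display.
[cite: AllenLaiShen2024, §3 (display before Lemma 3)] -/
theorem succ_mul_sq_singularValues_le_sum_sq_singularValues (T : E →ₗ[𝕜] F)
    (hn : finrank 𝕜 E = n) (k : ℕ) :
    (k + 1) * T.singularValues k ^ 2 ≤ ∑ j : Fin n, T.singularValues j ^ 2 := by
  by_cases hk : k < n
  · rw [Fin.sum_univ_eq_sum_range (fun j => T.singularValues j ^ 2) n]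
    calc (k + 1 : ℝ) * T.singularValues k ^ 2
        = ∑ j ∈ Finset.range (k + 1), T.singularValues k ^ 2 := by
          rw [Finset.sum_const, Finset.card_range, nsmul_eq_mul, Nat.cast_succ]
      _ ≤ ∑ j ∈ Finset.range (k + 1), T.singularValues j ^ 2 :=
          Finset.sum_le_sum fun j hj =>
            pow_le_pow_left₀ (T.singularValues_nonneg k)
              (T.singularValues_antitone (Nat.lt_succ_iff.mp (Finset.mem_range.mp hj))) 2
      _ ≤ ∑ j ∈ Finset.range n, T.singularValues j ^ 2 :=
          Finset.sum_le_sum_of_subset_of_nonneg (Finset.range_mono (Nat.succ_le_of_lt hk))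
            fun j _ _ => sq_nonneg _
  · rw [T.singularValues_of_finrank_le (hn.trans_le (not_lt.mp hk)), zero_pow two_ne_zero,
      mul_zero]
    exact Finset.sum_nonneg fun j _ => sq_nonneg _

/-- **`σ₀² + k σ_k² ≤ Σ_j σ_j²`**: besides `σ₀²`, the sum contains the `k` terms `σ₁², …, σ_k²`,
each `≥ σ_k²`.  With `k = dim E − 1` this is `‖L‖₂² + r σ_min(L)² ≤ ‖L‖_F²`, the step
`‖L‖₂² = ‖L‖_F² (1 − Σ_{k ≥ 2} σ_k²/Σ_k σ_k²) ≤ ‖L‖_F² − r σ_min(L)²` of the cited proof.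
[cite: AllenLaiShen2024, §3 (proof of Thm 3)] -/
theorem sq_singularValues_zero_add_mul_sq_singularValues_le_sum (T : E →ₗ[𝕜] F)
    (hn : finrank 𝕜 E = n) (k : ℕ) :
    T.singularValues 0 ^ 2 + k * T.singularValues k ^ 2 ≤ ∑ j : Fin n, T.singularValues j ^ 2 := by
  by_cases hk : k < n
  · rw [Fin.sum_univ_eq_sum_range (fun j => T.singularValues j ^ 2) n]
    calc T.singularValues 0 ^ 2 + (k : ℝ) * T.singularValues k ^ 2
        = T.singularValues 0 ^ 2 + ∑ j ∈ Finset.range k, T.singularValues k ^ 2 := by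
          rw [Finset.sum_const, Finset.card_range, nsmul_eq_mul]
      _ ≤ T.singularValues 0 ^ 2 + ∑ j ∈ Finset.range k, T.singularValues (j + 1) ^ 2 := by
          gcongr with j hj
          · exact T.singularValues_nonneg k
          · exact T.singularValues_antitone (Nat.succ_le_of_lt (Finset.mem_range.mp hj))
      _ = ∑ j ∈ Finset.range (k + 1), T.singularValues j ^ 2 := by
          rw [Finset.sum_range_succ' (fun j => T.singularValues j ^ 2) k, add_comm]
      _ ≤ ∑ j ∈ Finset.range n, T.singularValues j ^ 2 :=
          Finset.sum_le_sum_of_subset_of_nonneg (Finset.range_mono (Nat.succ_le_of_lt hk))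
            fun j _ _ => sq_nonneg _
  · rw [T.singularValues_of_finrank_le (hn.trans_le (not_lt.mp hk)), zero_pow two_ne_zero,
      mul_zero, add_zero]
    have h := succ_mul_sq_singularValues_le_sum_sq_singularValues T hn 0
    rwa [Nat.cast_zero, zero_add, one_mul] at h

/-- **`Σ_j σ_j² ≤ rank T · σ₀²`** (only the first `rank T` singular values are non-zero, each
`≤ σ₀`); with `rank ≤ min{m, n}` this is `‖A‖_F ≤ √min{m,n} ‖A‖₂`.
[cite: GolubVanLoan2013, §2.3.2 (2.3.7)] -/
theorem sum_sq_singularValues_le_finrank_range_mul_sq_singularValues_zero (T : E →ₗ[𝕜] F)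
    (hn : finrank 𝕜 E = n) :
    ∑ j : Fin n, T.singularValues j ^ 2 ≤
      finrank 𝕜 (LinearMap.range T) * T.singularValues 0 ^ 2 := by
  rw [Fin.sum_univ_eq_sum_range (fun j => T.singularValues j ^ 2) n]
  have hr : finrank 𝕜 (LinearMap.range T) ≤ n := hn ▸ LinearMap.finrank_range_le T
  rw [← Finset.sum_subset (Finset.range_mono hr) fun j _ hj => by
    rw [Finset.mem_range, not_lt] at hj
    rw [(T.singularValues_eq_zero_iff_le_finrank_range).mpr hj, zero_pow two_ne_zero]]
  calc ∑ j ∈ Finset.range (finrank 𝕜 (LinearMap.range T)), T.singularValues j ^ 2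
      ≤ ∑ j ∈ Finset.range (finrank 𝕜 (LinearMap.range T)), T.singularValues 0 ^ 2 :=
        Finset.sum_le_sum fun j _ =>
          pow_le_pow_left₀ (T.singularValues_nonneg j) (T.singularValues_antitone (Nat.zero_le j)) 2
    _ = finrank 𝕜 (LinearMap.range T) * T.singularValues 0 ^ 2 := by
        rw [Finset.sum_const, Finset.card_range, nsmul_eq_mul]

/-! ### Weyl's rank-perturbation inequality and Eckart–Young in the Frobenius norm -/

/-- **Weyl's inequality, rank form: `σ_{i+k}(T) ≤ σ_i(T − S)` whenever `rank S ≤ k`.**  (The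
additive Weyl inequality `σ_{i+j−1}(A + B) ≤ σ_i(A) + σ_j(B)` with `A + B ↦ T`, `A ↦ T − S`,
`B ↦ S`, `j = k + 1`, `σ_{k+1}(S) = 0`.)  Proof: `span {v₀, …, v_{i+k}} ∩ ker S` has dimension
`≥ i + 1`, and on it `‖(T − S) x‖ = ‖T x‖ ≥ σ_{i+k} ‖x‖`; conclude by the max–min characterisation
of `σ_i(T − S)`. [cite: HornJohnson2013, §7.3 7.3.P16 (7.3.13)]
[cite: GolubVanLoan2013, §2.4.2 Thm 2.4.8 (proof)] -/
theorem singularValues_add_le_singularValues_sub_of_finrank_range_le (T S : E →ₗ[𝕜] F) {k : ℕ}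
    (hS : finrank 𝕜 (LinearMap.range S) ≤ k) (i : ℕ) :
    T.singularValues (i + k) ≤ (T - S).singularValues i := by
  obtain ⟨n, hn⟩ : ∃ n, finrank 𝕜 E = n := ⟨_, rfl⟩
  by_cases hik : i + k < n
  · have e1 : finrank 𝕜 (Submodule.span 𝕜 (Set.range
        fun j : {j : Fin n // j ≤ (⟨i + k, hik⟩ : Fin n)} =>
          T.isSymmetric_adjoint_comp_self.eigenvectorBasis hn j)) = i + k + 1 :=
      Literature.Analysis.InnerProduct.finrank_headSpan T.isSymmetric_adjoint_comp_self hn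
        ⟨i + k, hik⟩
    set V : Submodule 𝕜 E := Submodule.span 𝕜 (Set.range
        fun j : {j : Fin n // j ≤ (⟨i + k, hik⟩ : Fin n)} =>
          T.isSymmetric_adjoint_comp_self.eigenvectorBasis hn j) with hV
    have e2 := S.finrank_range_add_finrank_ker
    rw [hn] at e2
    have e3 := Submodule.finrank_sup_add_finrank_inf_eq V (LinearMap.ker S)
    have e4 : finrank 𝕜 ↥(V ⊔ LinearMap.ker S) ≤ n := by
      rw [← hn]
      exact Submodule.finrank_le _
    refine le_singularValues_of_forall_mem_le_norm_apply (T - S) hn i (V ⊓ LinearMap.ker S)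
      (by omega) fun x hx => ?_
    obtain ⟨hxV, hxK⟩ := Submodule.mem_inf.mp hx
    rw [LinearMap.mem_ker] at hxK
    rw [LinearMap.sub_apply, hxK, sub_zero]
    exact singularValues_mul_norm_le_of_inner_eigenvectorBasis_eq_zero T hn (i + k)
      fun j hj => Literature.Analysis.InnerProduct.inner_eq_zero_of_mem_headSpan
        T.isSymmetric_adjoint_comp_self hn ⟨i + k, hik⟩ hxV j hj
  · rw [T.singularValues_of_finrank_le (hn.trans_le (not_lt.mp hik))]
    exact (T - S).singularValues_nonneg i

/-- **Eckart–Young in the Frobenius norm, lower bound.**  If `rank S ≤ k` then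
`Σ_{k ≤ j < dim E} σ_j(T)² ≤ Σ_i ‖T b_i − S b_i‖²` for every orthonormal basis `(b_i)`:
`‖A − B‖_F² ≥ Σ_{i > k} σ_i(A)²` for every `B` of rank `≤ k` (sum the squares of Weyl's rank
inequality). [cite: HornJohnson2013, §7.4.2] [cite: EckartYoung1936, p. 216 Eq. (17)]
[cite: GolubVanLoan2013, §2.4.2 Thm 2.4.8] -/
theorem sum_Ico_sq_singularValues_le_sum_sq_norm_sub_apply {ι : Type*} [Fintype ι]
    (T S : E →ₗ[𝕜] F) (hn : finrank 𝕜 E = n) {k : ℕ} (hS : finrank 𝕜 (LinearMap.range S) ≤ k)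
    (b : OrthonormalBasis ι 𝕜 E) :
    ∑ j ∈ Finset.Ico k n, T.singularValues j ^ 2 ≤ ∑ i, ‖T (b i) - S (b i)‖ ^ 2 := by
  have h1 : ∑ i, ‖T (b i) - S (b i)‖ ^ 2 = ∑ j ∈ Finset.range n, (T - S).singularValues j ^ 2 := by
    simp_rw [← LinearMap.sub_apply]
    rw [sum_sq_norm_apply_orthonormalBasis_eq_sum_sq_singularValues (T - S) hn b,
      Fin.sum_univ_eq_sum_range (fun j => (T - S).singularValues j ^ 2) n]
  rw [h1, Finset.sum_Ico_eq_sum_range]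
  calc ∑ j ∈ Finset.range (n - k), T.singularValues (k + j) ^ 2
      ≤ ∑ j ∈ Finset.range (n - k), (T - S).singularValues j ^ 2 :=
        Finset.sum_le_sum fun j _ => pow_le_pow_left₀ (T.singularValues_nonneg _)
          (by
            rw [add_comm]
            exact singularValues_add_le_singularValues_sub_of_finrank_range_le T S hS j) 2
    _ ≤ ∑ j ∈ Finset.range n, (T - S).singularValues j ^ 2 :=
        Finset.sum_le_sum_of_subset_of_nonneg (Finset.range_mono (Nat.sub_le n k))
          fun j _ _ => sq_nonneg _

/-- **Eckart–Young in the Frobenius norm, attainment (truncated singular value decomposition).**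
For every `k` there is `S` of rank `≤ k` — namely `S = T ∘ P` with `P` the orthogonal projection
onto `span {v₀, …, v_{k−1}}` — with `‖T x − S x‖ ≤ σ_k ‖x‖` for all `x` (optimal in the operator
norm) **and** `Σ_i ‖T b_i − S b_i‖² = Σ_{k ≤ j < dim E} σ_j(T)²` for every orthonormal basis `(b_i)`
(optimal in the Frobenius norm): "replace all but `r` of the diagonal elements of `λ` by zeros,
beginning with the smallest"; the minimum value is `Σ_{i = r+1}^{R} λ_i²`.
[cite: EckartYoung1936, p. 216 Eq. (17)] [cite: HornJohnson2013, §7.4.2]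
[cite: GolubVanLoan2013, §2.4.2 Thm 2.4.8] -/
theorem exists_finrank_range_le_sum_sq_norm_sub_apply_eq {ι : Type*} [Fintype ι]
    (T : E →ₗ[𝕜] F) (hn : finrank 𝕜 E = n) (k : ℕ) (b : OrthonormalBasis ι 𝕜 E) :
    ∃ S : E →ₗ[𝕜] F, finrank 𝕜 (LinearMap.range S) ≤ k ∧
      (∀ x, ‖T x - S x‖ ≤ T.singularValues k * ‖x‖) ∧
      ∑ i, ‖T (b i) - S (b i)‖ ^ 2 = ∑ j ∈ Finset.Ico k n, T.singularValues j ^ 2 := by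
  by_cases hk : n ≤ k
  · refine ⟨T, (LinearMap.finrank_range_le T).trans (hn.le.trans hk), fun x => ?_, ?_⟩
    · rw [sub_self, norm_zero]
      exact mul_nonneg (T.singularValues_nonneg k) (norm_nonneg x)
    · simp [Finset.Ico_eq_empty_of_le hk]
  rw [not_le] at hk
  set v := T.isSymmetric_adjoint_comp_self.eigenvectorBasis hn with hv
  obtain ⟨K, hK⟩ : ∃ K : Submodule 𝕜 E,
      K = Submodule.span 𝕜 (Set.range fun j : Fin k => v (Fin.castLE hk.le j)) := ⟨_, rfl⟩
  haveI : CompleteSpace K := FiniteDimensional.complete 𝕜 K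
  -- membership of the right singular vectors in `K` / `Kᗮ`
  have hmemK : ∀ j : Fin n, (j : ℕ) < k → v j ∈ K := fun j hj => by
    rw [hK]
    have : v j = v (Fin.castLE hk.le ⟨j, hj⟩) := congrArg v (Fin.ext (by simp))
    rw [this]
    exact Submodule.subset_span ⟨⟨j, hj⟩, rfl⟩
  have hmemKo : ∀ j : Fin n, k ≤ (j : ℕ) → v j ∈ Kᗮ := fun j hj => by
    rw [hK, Submodule.mem_orthogonal]
    intro u hu
    rw [← Submodule.mem_orthogonal_singleton_iff_inner_left]
    refine (Submodule.span_le.2 ?_) hu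
    rintro _ ⟨j', rfl⟩
    rw [SetLike.mem_coe, Submodule.mem_orthogonal_singleton_iff_inner_left]
    refine v.orthonormal.2 fun h => ?_
    have h' := congrArg Fin.val h
    simp only [Fin.val_castLE] at h'
    omega
  set S : E →ₗ[𝕜] F := T ∘ₗ (K.starProjection : E →L[𝕜] E).toLinearMap with hS
  have hSapp : ∀ x, S x = T (K.starProjection x) := fun x => rfl
  refine ⟨S, ?_, fun x => ?_, ?_⟩
  · -- rank bound
    have h1 : LinearMap.range S ≤ K.map T := by
      rintro _ ⟨x, rfl⟩
      exact ⟨K.starProjection x, K.starProjection_apply_mem x, rfl⟩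
    have h2 : finrank 𝕜 K ≤ k := by
      have h := finrank_range_le_card (R := 𝕜) fun j : Fin k => v (Fin.castLE hk.le j)
      rw [hK]
      simpa [Set.finrank] using h
    exact (Submodule.finrank_mono h1).trans ((Submodule.finrank_map_le T K).trans h2)
  · -- operator-norm bound (as in the spectral Eckart–Young theorem)
    have hy : x - K.starProjection x ∈ Kᗮ := K.sub_starProjection_mem_orthogonal x
    have horth : ∀ i : Fin n, (i : ℕ) < k → ⟪v i, x - K.starProjection x⟫_𝕜 = 0 :=
      fun i hi => Submodule.inner_right_of_mem_orthogonal (hmemK i hi) hy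
    have hle := norm_apply_le_of_inner_eigenvectorBasis_eq_zero T hn k horth
    have hPy : ‖x - K.starProjection x‖ ≤ ‖x‖ := by
      have h0 : ⟪x - K.starProjection x, K.starProjection x⟫_𝕜 = 0 :=
        Submodule.inner_left_of_mem_orthogonal (K.starProjection_apply_mem x) hy
      have hpy := norm_add_sq_eq_norm_sq_add_norm_sq_of_inner_eq_zero _ _ h0
      rw [sub_add_cancel] at hpy
      have hsq : ‖x - K.starProjection x‖ ^ 2 ≤ ‖x‖ ^ 2 := by
        rw [sq, sq, hpy]
        linarith [mul_self_nonneg ‖K.starProjection x‖]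
      exact le_of_sq_le_sq hsq (norm_nonneg x)
    calc ‖T x - S x‖ = ‖T (x - K.starProjection x)‖ := by rw [map_sub, hSapp]
      _ ≤ T.singularValues k * ‖x - K.starProjection x‖ := hle
      _ ≤ T.singularValues k * ‖x‖ := mul_le_mul_of_nonneg_left hPy (T.singularValues_nonneg k)
  · -- Frobenius identity: compute `Σ_i ‖(T − S) b_i‖²` in the basis of right singular vectors
    have key₁ : ∑ i, ‖T (b i) - S (b i)‖ ^ 2 = ∑ j : Fin n, (T - S).singularValues j ^ 2 := by
      simp_rw [← LinearMap.sub_apply]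
      exact sum_sq_norm_apply_orthonormalBasis_eq_sum_sq_singularValues (T - S) hn b
    have key₂ : ∑ i, ‖T (v i) - S (v i)‖ ^ 2 = ∑ j : Fin n, (T - S).singularValues j ^ 2 := by
      simp_rw [← LinearMap.sub_apply]
      exact sum_sq_norm_apply_orthonormalBasis_eq_sum_sq_singularValues (T - S) hn v
    rw [key₁, ← key₂]
    have happ : ∀ j : Fin n, ‖T (v j) - S (v j)‖ ^ 2 =
        if k ≤ (j : ℕ) then T.singularValues j ^ 2 else 0 := fun j => by
      split_ifs with hj
      · rw [hSapp, (Submodule.starProjection_apply_eq_zero_iff (K := K)).mpr (hmemKo j hj),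
          map_zero, sub_zero, hv, norm_apply_eigenvectorBasis_eq_singularValues T hn j]
      · rw [hSapp, Submodule.starProjection_eq_self_iff.mpr (hmemK j (not_le.mp hj)), sub_self,
          norm_zero, zero_pow two_ne_zero]
    simp_rw [happ]
    rw [Fin.sum_univ_eq_sum_range (fun j => if k ≤ j then T.singularValues j ^ 2 else 0) n,
      ← Finset.sum_filter]
    refine Finset.sum_congr ?_ fun _ _ => rfl
    ext j
    simp only [Finset.mem_filter, Finset.mem_range, Finset.mem_Ico]
    omega

end Operator

/-! ## Part II. Matrices -/

section MatrixForms

variable {𝕜 : Type*} [RCLike 𝕜] {m n : Type*} [Fintype m] [Fintype n] [DecidableEq n]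

/-- [folklore] `rank A = dim range (toEuclideanLin A)`. -/
private theorem rank_eq_finrank_range_toEuclideanLin' (A : Matrix m n 𝕜) :
    A.rank = finrank 𝕜 (LinearMap.range (Matrix.toEuclideanLin A)) :=
  Matrix.rank_eq_finrank_range_toLin A (EuclideanSpace.basisFun m 𝕜).toBasis
    (EuclideanSpace.basisFun n 𝕜).toBasis

/-- [folklore] The squared Euclidean norm of the `j`-th column: `‖A e_j‖₂² = Σ_i |a_ij|²`. -/
private theorem sq_norm_toEuclideanLin_basisFun (A : Matrix m n 𝕜) (j : n) :
    ‖Matrix.toEuclideanLin A (EuclideanSpace.basisFun n 𝕜 j)‖ ^ 2 = ∑ i, ‖A i j‖ ^ 2 := by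
  rw [EuclideanSpace.norm_sq_eq]
  refine Finset.sum_congr rfl fun i _ => ?_
  have h : (Matrix.toEuclideanLin A (EuclideanSpace.single j (1 : 𝕜))) i = A i j := by
    simp [Matrix.toLpLin_apply, PiLp.ofLp_single]
  rw [EuclideanSpace.basisFun_apply, h]

/-- [folklore] `Σ_{i,j} |a_ij|² = Σ_j ‖A e_j‖₂²` (sum of the squared column norms). -/
private theorem sum_sq_norm_entry_eq_sum_sq_norm_toEuclideanLin_basisFun (A : Matrix m n 𝕜) :
    ∑ i, ∑ j, ‖A i j‖ ^ 2 = ∑ j, ‖Matrix.toEuclideanLin A (EuclideanSpace.basisFun n 𝕜 j)‖ ^ 2 := by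
  rw [Finset.sum_comm]
  exact Finset.sum_congr rfl fun j _ => (sq_norm_toEuclideanLin_basisFun A j).symm

/-- **`Σ_{i,j} |a_ij|² = Σ_{k < |n|} σ_k(A)²`**: the squared Frobenius norm of a matrix is the sum
of the squares of its singular values (`‖A‖_F = √(σ₁² + ⋯ + σ_p²)`).
[cite: GolubVanLoan2013, §2.4.2 Cor 2.4.3] [cite: HornJohnson2013, §5.6 (5.6.0.2)] -/
theorem sum_sq_norm_entry_eq_sum_sq_singularValues (A : Matrix m n 𝕜) :
    ∑ i, ∑ j, ‖A i j‖ ^ 2 =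
      ∑ k : Fin (Fintype.card n), (Matrix.toEuclideanLin A).singularValues k ^ 2 := by
  rw [sum_sq_norm_entry_eq_sum_sq_norm_toEuclideanLin_basisFun]
  exact sum_sq_norm_apply_orthonormalBasis_eq_sum_sq_singularValues (Matrix.toEuclideanLin A)
    finrank_euclideanSpace _

/-- `Σ_{i,j} |a_ij|² = Σ_{k < d} σ_k(A)²` for any `d ≥ |n|`.
[cite: GolubVanLoan2013, §2.4.2 Cor 2.4.3] -/
theorem sum_sq_norm_entry_eq_sum_range_sq_singularValues (A : Matrix m n 𝕜) {d : ℕ}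
    (hd : Fintype.card n ≤ d) :
    ∑ i, ∑ j, ‖A i j‖ ^ 2 =
      ∑ k ∈ Finset.range d, (Matrix.toEuclideanLin A).singularValues k ^ 2 := by
  rw [sum_range_sq_singularValues_eq (Matrix.toEuclideanLin A) finrank_euclideanSpace hd,
    sum_sq_norm_entry_eq_sum_sq_singularValues]

/-- `Σ_{i,j} |a_ij|² = Σ_{k < p} σ_k(A)²` with `p = min{|m|, |n|}` (the singular values beyond
`rank A ≤ p` vanish). [cite: GolubVanLoan2013, §2.4.2 Cor 2.4.3] -/
theorem sum_sq_norm_entry_eq_sum_range_min_sq_singularValues (A : Matrix m n 𝕜) :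
    ∑ i, ∑ j, ‖A i j‖ ^ 2 =
      ∑ k ∈ Finset.range (min (Fintype.card m) (Fintype.card n)),
        (Matrix.toEuclideanLin A).singularValues k ^ 2 := by
  rw [sum_sq_norm_entry_eq_sum_range_sq_singularValues A le_rfl]
  refine (Finset.sum_subset (Finset.range_mono (min_le_right _ _)) fun k _ hk => ?_).symm
  rw [Finset.mem_range, not_lt] at hk
  have hr : A.rank ≤ k :=
    (le_min (Matrix.rank_le_card_height A) (Matrix.rank_le_card_width A)).trans hk
  rw [(singularValues_toEuclideanLin_eq_zero_iff_rank_le A k).mpr hr, zero_pow two_ne_zero]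

omit [DecidableEq n] in
/-- **`tr (AᴴA) = Σ_{i,j} |a_ij|²`** (as an element of `𝕜`).
[cite: HornJohnson2013, §5.6 (5.6.0.2)] -/
theorem trace_conjTranspose_mul_self_eq_sum_sq_norm_entry (A : Matrix m n 𝕜) :
    (A.conjTranspose * A).trace = ((∑ i, ∑ j, ‖A i j‖ ^ 2 : ℝ) : 𝕜) := by
  rw [Finset.sum_comm]
  simp only [Matrix.trace, Matrix.diag_apply, Matrix.mul_apply, Matrix.conjTranspose_apply,
    RCLike.star_def, RCLike.conj_mul, RCLike.ofReal_sum, RCLike.ofReal_pow]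

omit [DecidableEq n] in
/-- **`re tr (AᴴA) = Σ_{i,j} |a_ij|²`** (`‖A‖_F = |tr AA*|^{1/2}`).
[cite: HornJohnson2013, §5.6 (5.6.0.2)] -/
theorem re_trace_conjTranspose_mul_self (A : Matrix m n 𝕜) :
    RCLike.re (A.conjTranspose * A).trace = ∑ i, ∑ j, ‖A i j‖ ^ 2 := by
  rw [trace_conjTranspose_mul_self_eq_sum_sq_norm_entry, RCLike.ofReal_re]

/-- **`re tr (AᴴA) = Σ_k σ_k(A)²`**. [cite: HornJohnson2013, §5.6 (5.6.0.2)] -/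
theorem re_trace_conjTranspose_mul_self_eq_sum_sq_singularValues (A : Matrix m n 𝕜) :
    RCLike.re (A.conjTranspose * A).trace =
      ∑ k : Fin (Fintype.card n), (Matrix.toEuclideanLin A).singularValues k ^ 2 := by
  rw [re_trace_conjTranspose_mul_self, sum_sq_norm_entry_eq_sum_sq_singularValues]

/-! ### `‖A‖₂ ≤ ‖A‖_F ≤ √min{m,n} ‖A‖₂` and the Chebyshev bounds -/

/-- **`σ₀(A)² ≤ Σ_{i,j} |a_ij|²`** (`‖A‖₂ ≤ ‖A‖_F`). [cite: GolubVanLoan2013, §2.3.2 (2.3.7)] -/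
theorem sq_singularValues_zero_le_sum_sq_norm_entry (A : Matrix m n 𝕜) :
    (Matrix.toEuclideanLin A).singularValues 0 ^ 2 ≤ ∑ i, ∑ j, ‖A i j‖ ^ 2 := by
  have h := succ_mul_sq_singularValues_le_sum_sq_singularValues (Matrix.toEuclideanLin A)
    finrank_euclideanSpace 0
  rw [Nat.cast_zero, zero_add, one_mul] at h
  rwa [sum_sq_norm_entry_eq_sum_sq_singularValues]

/-- **`σ₀(A) ≤ ‖A‖_F = √(Σ_{i,j} |a_ij|²)`**. [cite: GolubVanLoan2013, §2.3.2 (2.3.7)] -/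
theorem singularValues_zero_le_sqrt_sum_sq_norm_entry (A : Matrix m n 𝕜) :
    (Matrix.toEuclideanLin A).singularValues 0 ≤ √(∑ i, ∑ j, ‖A i j‖ ^ 2) :=
  Real.le_sqrt_of_sq_le (sq_singularValues_zero_le_sum_sq_norm_entry A)

/-- **`Σ_{i,j} |a_ij|² ≤ rank A · σ₀(A)²`**. [cite: GolubVanLoan2013, §2.3.2 (2.3.7)] -/
theorem sum_sq_norm_entry_le_rank_mul_sq_singularValues_zero (A : Matrix m n 𝕜) :
    ∑ i, ∑ j, ‖A i j‖ ^ 2 ≤ A.rank * (Matrix.toEuclideanLin A).singularValues 0 ^ 2 := by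
  rw [sum_sq_norm_entry_eq_sum_sq_singularValues, rank_eq_finrank_range_toEuclideanLin']
  exact sum_sq_singularValues_le_finrank_range_mul_sq_singularValues_zero (Matrix.toEuclideanLin A)
    finrank_euclideanSpace

/-- **`Σ_{i,j} |a_ij|² ≤ min{|m|,|n|} · σ₀(A)²`** (`‖A‖_F ≤ √min{m,n} ‖A‖₂`).
[cite: GolubVanLoan2013, §2.3.2 (2.3.7)] -/
theorem sum_sq_norm_entry_le_min_card_mul_sq_singularValues_zero (A : Matrix m n 𝕜) :
    ∑ i, ∑ j, ‖A i j‖ ^ 2 ≤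
      min (Fintype.card m) (Fintype.card n) * (Matrix.toEuclideanLin A).singularValues 0 ^ 2 := by
  refine (sum_sq_norm_entry_le_rank_mul_sq_singularValues_zero A).trans ?_
  gcongr
  exact le_min (Matrix.rank_le_card_height A) (Matrix.rank_le_card_width A)

/-- **`‖A‖_F ≤ √min{m,n} ‖A‖₂`**, square-root form. [cite: GolubVanLoan2013, §2.3.2 (2.3.7)] -/
theorem sqrt_sum_sq_norm_entry_le_sqrt_min_card_mul_singularValues_zero (A : Matrix m n 𝕜) :
    √(∑ i, ∑ j, ‖A i j‖ ^ 2) ≤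
      √(min (Fintype.card m) (Fintype.card n)) * (Matrix.toEuclideanLin A).singularValues 0 := by
  rw [← Real.sqrt_sq ((Matrix.toEuclideanLin A).singularValues_nonneg 0),
    ← Real.sqrt_mul (x := (min (Fintype.card m) (Fintype.card n) : ℝ)) (by positivity)]
  exact Real.sqrt_le_sqrt
    (by exact_mod_cast sum_sq_norm_entry_le_min_card_mul_sq_singularValues_zero A)

/-- **`(k+1) σ_k(A)² ≤ Σ_{i,j} |a_ij|²`** (`‖M‖_F ≥ √(r+1) σ_{r+1}(M)`, one-indexed).
[cite: AllenLaiShen2024, §3 (display before Lemma 3)] -/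
theorem succ_mul_sq_singularValues_le_sum_sq_norm_entry (A : Matrix m n 𝕜) (k : ℕ) :
    (k + 1) * (Matrix.toEuclideanLin A).singularValues k ^ 2 ≤ ∑ i, ∑ j, ‖A i j‖ ^ 2 := by
  rw [sum_sq_norm_entry_eq_sum_sq_singularValues]
  exact succ_mul_sq_singularValues_le_sum_sq_singularValues (Matrix.toEuclideanLin A)
    finrank_euclideanSpace k

/-- **`σ_k(A) ≤ √(Σ_{i,j} |a_ij|² / (k+1))`**.
[cite: AllenLaiShen2024, §3 (display before Lemma 3)] -/
theorem singularValues_le_sqrt_sum_sq_norm_entry_div_succ (A : Matrix m n 𝕜) (k : ℕ) :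
    (Matrix.toEuclideanLin A).singularValues k ≤ √((∑ i, ∑ j, ‖A i j‖ ^ 2) / (k + 1)) := by
  refine Real.le_sqrt_of_sq_le ?_
  rw [le_div_iff₀ (by positivity), mul_comm]
  exact succ_mul_sq_singularValues_le_sum_sq_norm_entry A k

/-- **`σ₀(A)² + k σ_k(A)² ≤ Σ_{i,j} |a_ij|²`** (`‖L‖₂² + r σ_min(L)² ≤ ‖L‖_F²` for an
`(r+1) × (r+1)` block `L`, `k = r`). [cite: AllenLaiShen2024, §3 (proof of Thm 3)] -/
theorem sq_singularValues_zero_add_mul_sq_singularValues_le_sum_sq_norm_entry (A : Matrix m n 𝕜)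
    (k : ℕ) :
    (Matrix.toEuclideanLin A).singularValues 0 ^ 2 +
        k * (Matrix.toEuclideanLin A).singularValues k ^ 2 ≤ ∑ i, ∑ j, ‖A i j‖ ^ 2 := by
  rw [sum_sq_norm_entry_eq_sum_sq_singularValues]
  exact sq_singularValues_zero_add_mul_sq_singularValues_le_sum (Matrix.toEuclideanLin A)
    finrank_euclideanSpace k

omit [DecidableEq n] in
/-- [folklore] `Σ_{i,j} |a_ij|² ≤ |m| |n| δ²` when all `|a_ij| ≤ δ`. -/
private theorem sum_sq_norm_entry_le_card_mul_card_mul_sq (A : Matrix m n 𝕜) {δ : ℝ}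
    (h : ∀ i j, ‖A i j‖ ≤ δ) :
    ∑ i, ∑ j, ‖A i j‖ ^ 2 ≤ Fintype.card m * Fintype.card n * δ ^ 2 :=
  calc ∑ i, ∑ j, ‖A i j‖ ^ 2 ≤ ∑ _i : m, ∑ _j : n, δ ^ 2 :=
        Finset.sum_le_sum fun i _ => Finset.sum_le_sum fun j _ =>
          pow_le_pow_left₀ (norm_nonneg _) (h i j) 2
    _ = Fintype.card m * Fintype.card n * δ ^ 2 := by
        simp only [Finset.sum_const, Finset.card_univ, nsmul_eq_mul]
        ring

/-- **`σ_k(A) ≤ δ √(|m| |n| / (k+1))` when all `|a_ij| ≤ δ`** (`δ ≥ 0`): for a square block of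
order `r+1` and `k = r` this is `σ_{r+1}(A_{I,J}) ≤ √(r+1) ‖A‖_C`, the Chebyshev step of the cited
lemma (`‖·‖_F ≥ √(r+1) σ_{r+1}` and `‖·‖_F ≤ (r+1) ‖·‖_C`). [cite: AllenLaiShen2024, §3 Lemma 3] -/
theorem singularValues_le_mul_sqrt_card_mul_card_div_succ (A : Matrix m n 𝕜) {δ : ℝ}
    (hδ : 0 ≤ δ) (h : ∀ i j, ‖A i j‖ ≤ δ) (k : ℕ) :
    (Matrix.toEuclideanLin A).singularValues k ≤
      δ * √(Fintype.card m * Fintype.card n / (k + 1)) := by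
  rw [← Real.sqrt_sq hδ, ← Real.sqrt_mul (sq_nonneg δ)]
  refine Real.le_sqrt_of_sq_le ?_
  rw [mul_div_assoc', le_div_iff₀ (by positivity), mul_comm]
  calc (k + 1 : ℝ) * (Matrix.toEuclideanLin A).singularValues k ^ 2
      ≤ ∑ i, ∑ j, ‖A i j‖ ^ 2 := succ_mul_sq_singularValues_le_sum_sq_norm_entry A k
    _ ≤ Fintype.card m * Fintype.card n * δ ^ 2 := sum_sq_norm_entry_le_card_mul_card_mul_sq A h
    _ = δ ^ 2 * (Fintype.card m * Fintype.card n) := by ring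

/-! ### Weyl's rank inequality and Eckart–Young in the Frobenius norm, for matrices -/

/-- **`σ_{i+k}(A) ≤ σ_i(A − B)` whenever `rank B ≤ k`.**
[cite: HornJohnson2013, §7.3 7.3.P16 (7.3.13)] [cite: GolubVanLoan2013, §2.4.2 Thm 2.4.8 (proof)] -/
theorem singularValues_toEuclideanLin_add_le_of_rank_le (A B : Matrix m n 𝕜) {k : ℕ}
    (hB : B.rank ≤ k) (i : ℕ) :
    (Matrix.toEuclideanLin A).singularValues (i + k) ≤
      (Matrix.toEuclideanLin (A - B)).singularValues i := by
  rw [map_sub]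
  exact singularValues_add_le_singularValues_sub_of_finrank_range_le (Matrix.toEuclideanLin A)
    (Matrix.toEuclideanLin B) (by rwa [← rank_eq_finrank_range_toEuclideanLin']) i

/-- **Eckart–Young in the Frobenius norm for matrices, lower bound**: if `rank B ≤ k` then
`Σ_{k ≤ j < |n|} σ_j(A)² ≤ Σ_{i,j} |(A − B)_ij|²` (`‖A − B‖_F² ≥ Σ_{i > k} σ_i(A)²`).
[cite: HornJohnson2013, §7.4.2] [cite: EckartYoung1936, p. 216 Eq. (17)]
[cite: GolubVanLoan2013, §2.4.2 Thm 2.4.8] -/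
theorem sum_Ico_sq_singularValues_le_sum_sq_norm_entry_sub (A B : Matrix m n 𝕜) {k : ℕ}
    (hB : B.rank ≤ k) :
    ∑ j ∈ Finset.Ico k (Fintype.card n), (Matrix.toEuclideanLin A).singularValues j ^ 2 ≤
      ∑ i, ∑ j, ‖(A - B) i j‖ ^ 2 := by
  rw [sum_sq_norm_entry_eq_sum_sq_norm_toEuclideanLin_basisFun (A - B)]
  simp_rw [map_sub, LinearMap.sub_apply]
  exact sum_Ico_sq_singularValues_le_sum_sq_norm_sub_apply (Matrix.toEuclideanLin A)
    (Matrix.toEuclideanLin B) finrank_euclideanSpace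
    (by rwa [← rank_eq_finrank_range_toEuclideanLin']) _

/-- **Eckart–Young in the Frobenius norm for matrices, attainment**: for every `k` there is a matrix
`B` of rank `≤ k` (the truncated singular value decomposition `A_k`) with
`‖(A − B) x‖₂ ≤ σ_k(A) ‖x‖₂` for all `x` and `Σ_{i,j} |(A − B)_ij|² = Σ_{k ≤ j < |n|} σ_j(A)²`; so
`min_{rank B ≤ k} ‖A − B‖_F = (Σ_{j > k} σ_j(A)²)^{1/2}`, attained by the same `A_k` that is optimal
in the spectral norm. [cite: EckartYoung1936, p. 216 Eq. (17)] [cite: HornJohnson2013, §7.4.2]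
[cite: GolubVanLoan2013, §2.4.2 Thm 2.4.8] -/
theorem exists_rank_le_sum_sq_norm_entry_sub_eq (A : Matrix m n 𝕜) (k : ℕ) :
    ∃ B : Matrix m n 𝕜, B.rank ≤ k ∧
      (∀ x, ‖Matrix.toEuclideanLin (A - B) x‖ ≤
        (Matrix.toEuclideanLin A).singularValues k * ‖x‖) ∧
      ∑ i, ∑ j, ‖(A - B) i j‖ ^ 2 =
        ∑ j ∈ Finset.Ico k (Fintype.card n), (Matrix.toEuclideanLin A).singularValues j ^ 2 := by
  obtain ⟨S, hS, hSx, hSF⟩ := exists_finrank_range_le_sum_sq_norm_sub_apply_eq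
    (Matrix.toEuclideanLin A) finrank_euclideanSpace k (EuclideanSpace.basisFun n 𝕜)
  set B : Matrix m n 𝕜 := Matrix.toEuclideanLin.symm S with hB
  have hTB : Matrix.toEuclideanLin B = S := LinearEquiv.apply_symm_apply _ _
  refine ⟨B, ?_, fun x => ?_, ?_⟩
  · rw [rank_eq_finrank_range_toEuclideanLin', hTB]
    exact hS
  · rw [map_sub, hTB, LinearMap.sub_apply]
    exact hSx x
  · rw [sum_sq_norm_entry_eq_sum_sq_norm_toEuclideanLin_basisFun (A - B)]
    simp_rw [map_sub, hTB, LinearMap.sub_apply]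
    exact hSF

/-! ### The Frobenius norm instance -/

section FrobeniusNorm

open scoped Matrix.Norms.Frobenius

omit [DecidableEq n] in
/-- With Mathlib's (scoped) Frobenius norm on `Matrix m n 𝕜`: `‖A‖² = Σ_{i,j} |a_ij|²`.
[cite: GolubVanLoan2013, §2.3.1 (2.3.1)] -/
theorem frobenius_norm_sq_eq_sum_sq_norm_entry (A : Matrix m n 𝕜) :
    ‖A‖ ^ 2 = ∑ i, ∑ j, ‖A i j‖ ^ 2 := by
  rw [Matrix.frobenius_norm_def]
  simp_rw [Real.rpow_two]
  rw [← Real.sqrt_eq_rpow, Real.sq_sqrt (by positivity)]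

/-- **`‖A‖_F² = Σ_k σ_k(A)²`** for Mathlib's Frobenius norm instance.
[cite: GolubVanLoan2013, §2.4.2 Cor 2.4.3] [cite: HornJohnson2013, §5.6 (5.6.0.2)] -/
theorem frobenius_norm_sq_eq_sum_sq_singularValues (A : Matrix m n 𝕜) :
    ‖A‖ ^ 2 = ∑ k : Fin (Fintype.card n), (Matrix.toEuclideanLin A).singularValues k ^ 2 := by
  rw [frobenius_norm_sq_eq_sum_sq_norm_entry, sum_sq_norm_entry_eq_sum_sq_singularValues]

/-- **`‖A‖_F = √(Σ_k σ_k(A)²)`** for Mathlib's Frobenius norm instance.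
[cite: GolubVanLoan2013, §2.4.2 Cor 2.4.3] -/
theorem frobenius_norm_eq_sqrt_sum_sq_singularValues (A : Matrix m n 𝕜) :
    ‖A‖ = √(∑ k : Fin (Fintype.card n), (Matrix.toEuclideanLin A).singularValues k ^ 2) := by
  rw [← frobenius_norm_sq_eq_sum_sq_singularValues, Real.sqrt_sq (norm_nonneg A)]

/-- **`σ₀(A) ≤ ‖A‖_F ≤ √min{m,n} σ₀(A)`** for Mathlib's Frobenius norm instance
(`‖A‖₂ ≤ ‖A‖_F ≤ √min{m,n} ‖A‖₂`). [cite: GolubVanLoan2013, §2.3.2 (2.3.7)] -/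
theorem singularValues_zero_le_frobenius_norm_and_le (A : Matrix m n 𝕜) :
    (Matrix.toEuclideanLin A).singularValues 0 ≤ ‖A‖ ∧
      ‖A‖ ≤ √(min (Fintype.card m) (Fintype.card n)) *
        (Matrix.toEuclideanLin A).singularValues 0 := by
  have h : ‖A‖ = √(∑ i, ∑ j, ‖A i j‖ ^ 2) := by
    rw [← frobenius_norm_sq_eq_sum_sq_norm_entry, Real.sqrt_sq (norm_nonneg A)]
  rw [h]
  exact ⟨singularValues_zero_le_sqrt_sum_sq_norm_entry A,
    sqrt_sum_sq_norm_entry_le_sqrt_min_card_mul_singularValues_zero A⟩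

/-- **Eckart–Young in the Frobenius norm** for Mathlib's Frobenius norm instance:
`Σ_{j ≥ k} σ_j(A)² ≤ ‖A − B‖²` for every `B` of rank `≤ k`, with equality for some such `B`.
[cite: EckartYoung1936, p. 216 Eq. (17)] [cite: HornJohnson2013, §7.4.2]
[cite: GolubVanLoan2013, §2.4.2 Thm 2.4.8] -/
theorem frobenius_eckartYoung (A : Matrix m n 𝕜) (k : ℕ) :
    (∀ B : Matrix m n 𝕜, B.rank ≤ k →
      ∑ j ∈ Finset.Ico k (Fintype.card n), (Matrix.toEuclideanLin A).singularValues j ^ 2 ≤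
        ‖A - B‖ ^ 2) ∧
    ∃ B : Matrix m n 𝕜, B.rank ≤ k ∧
      ‖A - B‖ ^ 2 =
        ∑ j ∈ Finset.Ico k (Fintype.card n), (Matrix.toEuclideanLin A).singularValues j ^ 2 := by
  refine ⟨fun B hB => ?_, ?_⟩
  · rw [frobenius_norm_sq_eq_sum_sq_norm_entry]
    exact sum_Ico_sq_singularValues_le_sum_sq_norm_entry_sub A B hB
  · obtain ⟨B, hB, -, hBF⟩ := exists_rank_le_sum_sq_norm_entry_sub_eq A k
    exact ⟨B, hB, by rw [frobenius_norm_sq_eq_sum_sq_norm_entry, hBF]⟩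

end FrobeniusNorm

end MatrixForms

end Literature.LinearAlgebra.Matrix
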